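import Summits.RiemannHypothesis.RiemannHypothesis.Theorems.SpectralTraceWindowStepConjugateSplit
import Summits.RiemannHypothesis.RiemannHypothesis.Theorems.SpectralTraceWindowStepSharpMultiplicityCap
import HarnessLib

/-!
# Child 2 of the split, opened to its registered residual after the sharp cap (line `conjugate-point`)

Crux `stmt-RiemannHypothesis-14659` (`SpectralTrace.WindowStep`), line `conjugate-point`, skeleton v5.
The edge child `NoDegenerateEdge` of the prepared route split reduces to the dense-coagulation residual
(`noDegenerateEdge_of_coagulationDense`, `Theorems/SpectralTraceWindowStepConjugateSplit.lean`); the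
sharp Christoffel cap (`ncard_fibre_le_sharp`, `coagulationDense_of_inv_lt`, p142955) makes that residual
VACUOUS for every density parameter `δ > 1/(2a)`. This file records the consequence for the split:

* `noDegenerateEdge_of_coagulationSaturated` — child 2 follows from the SATURATED residual alone
  (`0 < δ ≤ 1/(2a)`; the registered stub `stub_coagulationSaturated` of skeleton v5);
* `coagulationSaturated_of_windowStep` — the saturated residual is crux-implied (honesty: nothing
  registered is stronger than the crux);
* `windowStep_iff_crystRegular_and_coagulationSaturated` — the EXACT accounting of skeleton v5:
  `WindowStep ↔ CrystRegular ∧ CoagulationSaturated`.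

Axioms ⊆ {propext, Classical.choice, Quot.sound}.
-/

set_option linter.dupNamespace false

noncomputable section

open Complex Set Filter
open scoped Topology

namespace Summit.RiemannHypothesis.RiemannHypothesis.Theorems.SpectralTraceWindowStep

open Literature.NumberTheory.LFunctions
open Summit.RiemannHypothesis.RiemannHypothesis.Theses.SpectralTrace
open Summit.RiemannHypothesis.RiemannHypothesis.Theorems
open Summit.RiemannHypothesis.RiemannHypothesis.Theorems.WindowStep.Negative
open Summit.RiemannHypothesis.RiemannHypothesis.Theorems.WeilWindowFlowGronwallLeakage

/-- `Trace(A)` (file-local notation, verbatim the shape of `WindowTraceArch` / `WindowStep`). -/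
local notation3 "WTrace " A:max => ∃ (ι : Type) (γ : ι → ℝ), ∀ g : ℝ → ℂ, IsWeilTest g →
  tsupport g ⊆ Set.Icc (-A) A →
    HasSum (fun i => weilMellin g (1 / 2 + (γ i : ℂ) * I)) (weilFunctional g)

/-- The saturated-coagulation residual (skeleton v5 `CoagulationSaturated`, spelled out): at a
conjugate point `a ≥ (log 3)/2`, no level-`2a` family whose multiplicities have upper logarithmic
density `≥ δ` for some `0 < δ ≤ 1/(2a)` lies in the real zero set of a ground-state transform.
File-local notation. -/
local notation3 "CoagSat" => ∀ a : ℝ, Real.log 3 / 2 ≤ a →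
  Literature.NumberTheory.LFunctions.weilGroundEnergy a = 0 →
    ∀ u : ℝ → ℂ, Literature.NumberTheory.LFunctions.IsWeilGroundState a u →
      ∀ (ι : Type) (γ : ι → ℝ) (δ : ℝ), 0 < δ → δ ≤ 1 / (2 * a) →
        (∀ X : ℝ, ∃ x : ℝ, X ≤ |x| ∧ δ * Real.log |x| < ({i : ι | γ i = x}.ncard : ℝ)) →
        (∀ g : ℝ → ℂ, Literature.NumberTheory.LFunctions.IsWeilTest g →
          tsupport g ⊆ Set.Icc (-(2 * a)) (2 * a) →
            HasSum (fun i => Literature.NumberTheory.LFunctions.weilMellin g (1 / 2 + (γ i : ℂ) * Complex.I))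
              (Literature.NumberTheory.LFunctions.weilFunctional g)) →
        ∃ i : ι, Literature.NumberTheory.LFunctions.weilMellin u (1 / 2 + (γ i : ℂ) * Complex.I) ≠ 0

/-- **Child 2 of the split from the saturated residual.** For `a ≥ (log 3)/2`: if every level below
`2a` is a rung then `0 < ε(a)` — given only the residual with density parameter `δ ≤ 1/(2a)`; the
range `δ > 1/(2a)` is supplied by the sharp cap (`coagulationDense_of_inv_lt`). [folklore] -/
theorem noDegenerateEdge_of_coagulationSaturated :
    (∀ a : ℝ, Real.log 3 / 2 ≤ a → Literature.NumberTheory.LFunctions.weilGroundEnergy a = 0 →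
      ∀ u : ℝ → ℂ, Literature.NumberTheory.LFunctions.IsWeilGroundState a u →
        ∀ (ι : Type) (γ : ι → ℝ) (δ : ℝ), 0 < δ → δ ≤ 1 / (2 * a) →
          (∀ X : ℝ, ∃ x : ℝ, X ≤ |x| ∧ δ * Real.log |x| < ({i : ι | γ i = x}.ncard : ℝ)) →
          (∀ g : ℝ → ℂ, Literature.NumberTheory.LFunctions.IsWeilTest g →
            tsupport g ⊆ Set.Icc (-(2 * a)) (2 * a) →
              HasSum (fun i => Literature.NumberTheory.LFunctions.weilMellin g (1 / 2 + (γ i : ℂ) * Complex.I))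
                (Literature.NumberTheory.LFunctions.weilFunctional g)) →
          ∃ i : ι, Literature.NumberTheory.LFunctions.weilMellin u (1 / 2 + (γ i : ℂ) * Complex.I) ≠ 0) →
    ∀ a : ℝ, Real.log 3 / 2 ≤ a →
      (∀ B : ℝ, 0 < B → B < 2 * a →
        ∃ (ι : Type) (γ : ι → ℝ), ∀ g : ℝ → ℂ, Literature.NumberTheory.LFunctions.IsWeilTest g →
          tsupport g ⊆ Set.Icc (-B) B →
            HasSum (fun i => Literature.NumberTheory.LFunctions.weilMellin g (1 / 2 + (γ i : ℂ) * Complex.I))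
              (Literature.NumberTheory.LFunctions.weilFunctional g)) →
      0 < Literature.NumberTheory.LFunctions.weilGroundEnergy a := by
  intro hX
  refine noDegenerateEdge_of_coagulationDense fun a ha h0 u hu ι γ δ hδ hdense hγ => ?_
  have hapos : 0 < a := lt_of_lt_of_le (by positivity) ha
  by_cases hle : δ ≤ 1 / (2 * a)
  · exact hX a ha h0 u hu ι γ δ hδ hle hdense hγ
  · exact coagulationDense_of_inv_lt a hapos u ι γ δ (lt_of_not_ge hle) hdense hγ

/-- **The saturated residual is crux-implied**: a level-`2a` family with `2a ≥ log 3 > log 2`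
contains the seed, so under `WindowStep` RH holds (Collapse), `ε(a) > 0`, and no conjugate point
exists. [folklore] -/
theorem coagulationSaturated_of_windowStep
    (hStep : Summit.RiemannHypothesis.RiemannHypothesis.Theses.SpectralTrace.WindowStep) : CoagSat := by
  intro a ha h0 u hu ι γ _ _ _ _ hγ
  exfalso
  have hlog3 : Real.log 2 ≤ Real.log 3 := Real.log_le_log two_pos (by norm_num)
  have h2a : Real.log 2 ≤ 2 * a := by linarith
  have hArch : WindowTraceArch := windowTrace_anti h2a ⟨ι, γ, hγ⟩
  have hRH := riemannHypothesis_of_windowTraceArch_of_windowStep hArch hStep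
  have hapos : 0 < a := lt_of_lt_of_le (by positivity) ha
  have hpos : WeilPositivityOn (a + 1) :=
    WeilPositivityOn.of_riemannHypothesis explicit_formula_holds hRH (a + 1)
  have := weilGroundEnergy_pos_of_weilPositivityOn_of_lt hpos hapos (by linarith)
  linarith

/-- **Exact accounting of skeleton v5**: `WindowStep ↔ CrystRegular ∧ CoagulationSaturated`
(glue `windowStep_of_dichotomy` through `noDegenerateEdge_of_coagulationSaturated`; converse by
`crystRegular_of_windowStep'` and `coagulationSaturated_of_windowStep`). Jointly the two registered
stubs are `WindowTraceArch → RH` (`riemannHypothesis_of_dichotomy`). [folklore] -/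
theorem windowStep_iff_crystRegular_and_coagulationSaturated :
    Summit.RiemannHypothesis.RiemannHypothesis.Theses.SpectralTrace.WindowStep ↔
      ((∀ B : ℝ, Real.log 2 ≤ B →
          Summit.RiemannHypothesis.RiemannHypothesis.Theses.SpectralTrace.WindowTraceArch →
            0 < Literature.NumberTheory.LFunctions.weilGroundEnergy (B / 2) → WTrace B) ∧
        CoagSat) :=
  ⟨fun h => ⟨crystRegular_of_windowStep' h, coagulationSaturated_of_windowStep h⟩,
    fun h => windowStep_of_dichotomy h.1 (noDegenerateEdge_of_coagulationSaturated h.2)⟩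

end Summit.RiemannHypothesis.RiemannHypothesis.Theorems.SpectralTraceWindowStep

end
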